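import Literature.IUT.HodgeArakelov.AbsTopInterfaces

/-!
# [IUTchII] Example 1.8: NON-VACUITY of the [AbsTopIII] output interface `AbsTopMonoids` — and its exact
# inhabitation condition «`Δ ⊆ Π` is characteristic»

Mochizuki, *Inter-universal Teichmüller theory II*, §1, Example 1.8 (i)–(ix), kurims manuscript (Dec. 2020)
pp. 35–42 [claim: Mochizuki2012, status: disputed] (IUTchII §1 Ex 1.8, kurims pp.35-42). Record-only
vocabulary under the claim key `Mochizuki2012` (D-0012, disputed); abc-iut cell, layer L6, NON-VACUITY
CERTIFICATE (cell referee protocol: a typed interface all of whose consumers are conditional must be shown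
INHABITED, lest the conditional theorems be vacuous) for abc-iut-L6-t1's interface
`Literature.IUT.HodgeArakelov.AbsTopMonoids S` (`AbsTopInterfaces.lean`, p406630), over which [IUTchII]
Cor. 1.11 / 1.12, the Galois-pair rigidity data (`GaloisPairRigidityData.tautological`, "over every `A`"), the
Prop. 3.1 (ii) / 3.4 (ii) junctions (`ThetaEnvData.KummerInput`, `Prop34iiUniradialContent`) and Remarks
1.8.1 / 1.11.1 are typed.  Before this file the tree contained NO term of type `AbsTopMonoids S`
(every occurrence was a binder), so all of these were uninstantiated.

What the kernel says (this file; no `def … : Prop`, no named fact, nothing asserted about print):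

* NECESSITY. Any `A : AbsTopMonoids S` forces
  (H1) `S.DeltaX.map f = S.DeltaX` for EVERY automorphism of topological groups `f : Π^tp_{X̲̲_k} ≃ₜ* Π^tp_{X̲̲_k}`
  (`AbsTopMonoids.deltaX_map_autEquiv`: the interface law `Delta_map` at the automorphisms of the reference
  object, with `Delta_base`) — i.e. the interface silently carries «`Δ ⊆ Π` is group-theoretic /
  characteristic», the [AbsAnab] Lemma 1.3.8 shape that Example 1.8 (i) cites (kurims p. 35: "the subgroup
  `Δ ⊆ Π` … may be characterized group-theoretically"; cf. abc-iut-L4-t4's `FundamentalExtension.PreservesGeom`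
  at `E = F`), and
  (H2) `Nonempty (Π^tp_{X̲̲_k}/Δ ≃ₜ* G_k)` (`AbsTopMonoids.nonempty_quotDeltaX_iso`: the law `quotIso` at the
  reference object).
* SUFFICIENCY. Conversely (H1) ∧ (H2) suffice: `AbsTopMonoids.degenerate hΔ hq : AbsTopMonoids S` — the
  DEGENERATE witness with all monoids `O^⊳(G)`, `M_TM(Π)` and the isometry groups `Ism(G)` trivial, and
  `Δ(Π*) := Δ` transported along a chosen isomorphism `Π* ≅ Π^tp_{X̲̲_k}` (well defined and functorial in
  isomorphisms `Π* ≅ Π**` EXACTLY because of (H1)).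
* Hence `AbsTopMonoids.nonempty_iff : Nonempty (AbsTopMonoids S) ↔ (H1) ∧ (H2)` — the exact inhabitation
  condition of the interface.  HONEST LABEL: the witness is degenerate (trivial monoids); it certifies joint
  satisfiability of the typed laws and isolates the hidden hypothesis (H1); the GENUINE instance (the
  [AbsTopIII] Def. 3.1 / Prop. 5.8 monoids `O^⊳_{k̄}`, `Π ↷ M_TM(Π)`) is the cell's MERGE-MAP row B9
  (abc-iut-L4-t2/L4-t3).  Nothing here bears on [IUTchIII] Cor. 3.12; no side is taken.
-/

noncomputable section

namespace Literature.IUT.HodgeArakelov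

open CategoryTheory

universe u

variable {S : ThetaSetting.{u}}

namespace AbsTopMonoids

/-! ## Necessity: what every `A : AbsTopMonoids S` forces on the setting -/

/-- **(H1) is forced**: for any `A : AbsTopMonoids S`, `Δ = Ker(Π^tp_{X̲̲_k} ↠ G_k)` is carried onto itself by
EVERY automorphism of topological groups of `Π^tp_{X̲̲_k}` — the law `Delta_map` at the automorphisms of the
reference object `IsoClass.base S.PiX`, read through `Delta_base`. ("the subgroup `Δ ⊆ Π` … may be
characterized group-theoretically", IUTchII Ex. 1.8 (i).) [claim: Mochizuki2012, status: disputed]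
(IUTchII §1 Ex 1.8 (i), kurims p.35) -/
theorem deltaX_map_autEquiv (A : AbsTopMonoids S) (f : S.PiX ≃ₜ* S.PiX) :
    S.DeltaX.map f.toMulEquiv.toMonoidHom = S.DeltaX := by
  have h := A.Delta_map (P := IsoClass.base S.PiX) (Q := IsoClass.base S.PiX) f
  rwa [A.Delta_base] at h

/-- Elementwise form of (H1) as forced by `A`: `x ∈ Δ ↔ f x ∈ Δ`. [claim: Mochizuki2012, status: disputed]
(IUTchII §1 Ex 1.8 (i), kurims p.35) -/
theorem mem_deltaX_iff_of_autEquiv (A : AbsTopMonoids S) (f : S.PiX ≃ₜ* S.PiX) (x : S.PiX) :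
    f x ∈ S.DeltaX ↔ x ∈ S.DeltaX := by
  constructor
  · intro hx
    have h2 : f.symm (f x) ∈ S.DeltaX.map f.symm.toMulEquiv.toMonoidHom := Subgroup.mem_map_of_mem _ hx
    rw [A.deltaX_map_autEquiv f.symm] at h2
    simpa using h2
  · intro hx
    have h2 : f x ∈ S.DeltaX.map f.toMulEquiv.toMonoidHom := Subgroup.mem_map_of_mem _ hx
    rwa [A.deltaX_map_autEquiv f] at h2

/-- **(H2) is forced**: for any `A : AbsTopMonoids S`, `Π^tp_{X̲̲_k}/Δ ≅ G_k` as topological groups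
(abstractly) — the law `quotIso` at the reference object, transported along `Delta_base`.
[claim: Mochizuki2012, status: disputed] (IUTchII §1 Ex 1.8 (i), kurims pp.35-36) -/
theorem nonempty_quotDeltaX_iso (A : AbsTopMonoids S) :
    Nonempty (TopGroup.quot S.PiX S.DeltaX ≃ₜ* S.Gk) := by
  obtain ⟨e⟩ := A.quotIso (IsoClass.base S.PiX)
  have hmap : S.DeltaX.map (MulEquiv.refl S.PiX : S.PiX →* S.PiX) = A.Delta (IsoClass.base S.PiX) := by
    rw [MulEquiv.coe_monoidHom_refl, Subgroup.map_id, A.Delta_base]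
  refine ⟨ContinuousMulEquiv.trans ?_ e⟩
  exact
    { toMulEquiv := QuotientGroup.congr S.DeltaX (A.Delta (IsoClass.base S.PiX)) (MulEquiv.refl S.PiX) hmap
      continuous_toFun := by
        refine (QuotientGroup.isQuotientMap_mk S.DeltaX).continuous_iff.2 ?_
        exact QuotientGroup.continuous_mk
      continuous_invFun := by
        refine (QuotientGroup.isQuotientMap_mk (A.Delta (IsoClass.base S.PiX))).continuous_iff.2 ?_
        exact QuotientGroup.continuous_mk }

/-! ## Sufficiency: the degenerate witness under (H1) ∧ (H2) -/

section Degenerate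

variable (hΔ : ∀ f : S.PiX ≃ₜ* S.PiX, S.DeltaX.map f.toMulEquiv.toMonoidHom = S.DeltaX)

include hΔ in
/-- Under (H1), membership in `Δ` is invariant under every automorphism of `Π^tp_{X̲̲_k}`.
[claim: Mochizuki2012, status: disputed] (IUTchII §1 Ex 1.8 (i), kurims p.35) -/
theorem mem_deltaX_iff_of_char (f : S.PiX ≃ₜ* S.PiX) (x : S.PiX) : f x ∈ S.DeltaX ↔ x ∈ S.DeltaX := by
  constructor
  · intro hx
    have h2 : f.symm (f x) ∈ S.DeltaX.map f.symm.toMulEquiv.toMonoidHom := Subgroup.mem_map_of_mem _ hx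
    rw [hΔ f.symm] at h2
    simpa using h2
  · intro hx
    have h2 : f x ∈ S.DeltaX.map f.toMulEquiv.toMonoidHom := Subgroup.mem_map_of_mem _ hx
    rwa [hΔ f] at h2

/-- A chosen isomorphism `Π* ≅ Π^tp_{X̲̲_k}` for an isomorph `Π*` (it exists by definition of `IsoClass`).
[claim: Mochizuki2012, status: disputed] (IUTchII §1 Ex 1.8 (i), kurims p.35) -/
def chosenIso (P : IsoClass S.PiX) : P.G ≃ₜ* S.PiX := Classical.choice P.iso

/-- `Δ(Π*) := Δ` transported along the chosen `Π* ≅ Π^tp_{X̲̲_k}` (preimage; an `abbrev`, so that normality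
`Subgroup.normal_comap` is found by instance search — no `instance` is declared in this file).
[claim: Mochizuki2012, status: disputed] (IUTchII §1 Ex 1.8 (i), kurims p.35) -/
abbrev deltaOf (P : IsoClass S.PiX) : Subgroup P.G := S.DeltaX.comap (chosenIso P).toMulEquiv.toMonoidHom

/-- `Δ(Π*)` is normal (by `Subgroup.normal_comap`). [claim: Mochizuki2012, status: disputed] (IUTchII §1 Ex 1.8 (i), kurims p.35) -/
theorem deltaOf_normal (P : IsoClass S.PiX) : (deltaOf P).Normal := inferInstance

/-- Membership in `Δ(Π*)`. [claim: Mochizuki2012, status: disputed] (IUTchII §1 Ex 1.8 (i), kurims p.35) -/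
theorem mem_deltaOf_iff (P : IsoClass S.PiX) (x : P.G) : x ∈ deltaOf P ↔ chosenIso P x ∈ S.DeltaX :=
  Iff.rfl

include hΔ in
/-- Under (H1), `Δ(−)` is FUNCTORIAL in isomorphisms `Π* ≅ Π**`: the interface law `Delta_map`.
[claim: Mochizuki2012, status: disputed] (IUTchII §1 Ex 1.8 (i), kurims p.35) -/
theorem deltaOf_map {P Q : IsoClass S.PiX} (f : P ⟶ Q) :
    (deltaOf P).map (IsoClass.homIso f).toMulEquiv.toMonoidHom = deltaOf Q := by
  ext x
  rw [Subgroup.mem_map]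
  constructor
  · rintro ⟨y, hy, rfl⟩
    rw [mem_deltaOf_iff] at hy
    change chosenIso Q (IsoClass.homIso f y) ∈ S.DeltaX
    -- the automorphism `g := (chosenIso P)⁻¹ ≫ f ≫ chosenIso Q` of `Π^tp_{X̲̲_k}` carries `Δ` onto itself
    let g : S.PiX ≃ₜ* S.PiX := ((chosenIso P).symm.trans (IsoClass.homIso f)).trans (chosenIso Q)
    have hg : g (chosenIso P y) = chosenIso Q (IsoClass.homIso f y) := by
      simp [g]
    rw [← hg, mem_deltaX_iff_of_char hΔ g]
    exact hy
  · intro hx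
    rw [mem_deltaOf_iff] at hx
    refine ⟨(IsoClass.homIso f).symm x, ?_, (IsoClass.homIso f).apply_symm_apply x⟩
    rw [mem_deltaOf_iff]
    let g : S.PiX ≃ₜ* S.PiX := ((chosenIso Q).symm.trans (IsoClass.homIso f).symm).trans (chosenIso P)
    have hg : g (chosenIso Q x) = chosenIso P ((IsoClass.homIso f).symm x) := by
      simp [g]
    rw [← hg, mem_deltaX_iff_of_char hΔ g]
    exact hx

include hΔ in
/-- Under (H1), `Δ` of the reference object is `Δ` itself (the chosen automorphism of `Π^tp_{X̲̲_k}` preserves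
`Δ`): the interface law `Delta_base`. [claim: Mochizuki2012, status: disputed] (IUTchII §1 Ex 1.8 (i), kurims p.35) -/
theorem deltaOf_base : deltaOf (IsoClass.base S.PiX) = S.DeltaX := by
  ext x
  rw [mem_deltaOf_iff]
  exact mem_deltaX_iff_of_char hΔ (chosenIso (IsoClass.base S.PiX)) x

/-- `Π*/Δ(Π*) ≅ Π^tp_{X̲̲_k}/Δ` as topological groups, induced by the chosen `Π* ≅ Π^tp_{X̲̲_k}`.
[claim: Mochizuki2012, status: disputed] (IUTchII §1 Ex 1.8 (i), kurims pp.35-36) -/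
def quotDeltaOfIso (P : IsoClass S.PiX) : TopGroup.quot P.G (deltaOf P) ≃ₜ* TopGroup.quot S.PiX S.DeltaX :=
  { toMulEquiv := QuotientGroup.congr (deltaOf P) S.DeltaX (chosenIso P).toMulEquiv (by
        ext x
        rw [Subgroup.mem_map]
        constructor
        · rintro ⟨y, hy, rfl⟩
          exact hy
        · intro hx
          refine ⟨(chosenIso P).symm x, ?_, (chosenIso P).apply_symm_apply x⟩
          rw [mem_deltaOf_iff]
          simpa using hx)
    continuous_toFun := by
      refine (QuotientGroup.isQuotientMap_mk (deltaOf P)).continuous_iff.2 ?_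
      exact QuotientGroup.continuous_mk.comp (chosenIso P).continuous
    continuous_invFun := by
      refine (QuotientGroup.isQuotientMap_mk S.DeltaX).continuous_iff.2 ?_
      exact QuotientGroup.continuous_mk.comp (chosenIso P).symm.continuous }

/-- **SUFFICIENCY — the DEGENERATE `AbsTopMonoids S`** under (H1) «`Δ` characteristic» and (H2)
«`Π^tp_{X̲̲_k}/Δ ≅ G_k`»: all monoids `O^⊳(G)`, `M_TM(Π)`, all actions, all transports and all isometry groups
`Ism(G)` TRIVIAL; `Δ(Π*) :=` the transport of `Δ`; `Π*/Δ* ≅ G_k` through (H2).  Certifies that the typed laws of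
IUTchII Ex. 1.8 (ii)–(ix) are jointly satisfiable exactly when (H1) ∧ (H2); says nothing about the genuine
[AbsTopIII] monoids. [claim: Mochizuki2012, status: disputed] (IUTchII §1 Ex 1.8 (ii)-(ix), kurims pp.36-41) -/
def degenerate (hq : Nonempty (TopGroup.quot S.PiX S.DeltaX ≃ₜ* S.Gk)) : AbsTopMonoids S where
  Otri _ := PUnit.{u + 1}
  actOtri _ := 1
  mapOtri _ := MulEquiv.refl _
  mapOtri_id _ := rfl
  mapOtri_comp _ _ := rfl
  mapOtri_equivariant _ _ _ := rfl
  MTM _ := PUnit.{u + 1}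
  actMTM _ := 1
  mapMTM _ := MulEquiv.refl _
  mapMTM_id _ := rfl
  mapMTM_comp _ _ := rfl
  mapMTM_equivariant _ _ _ := rfl
  Delta P := deltaOf P
  Delta_map f := deltaOf_map hΔ f
  Delta_base := deltaOf_base hΔ
  quotIso P := ⟨(quotDeltaOfIso P).trans (Classical.choice hq)⟩
  tauto _ := MulEquiv.refl _
  tauto_equivariant _ _ _ := rfl
  Ism _ := PUnit.{u + 1}
  actIsm _ := 1
  toIsm _ := 1

end Degenerate

/-- **The exact inhabitation condition of the interface** `AbsTopMonoids S` (IUTchII Ex. 1.8 (ii)–(ix) outputs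
over `IsoClass Π^tp_{X̲̲_k}`, `IsoClass G_k`): it is inhabited iff (H1) `Δ ⊆ Π^tp_{X̲̲_k}` is carried onto itself by
every automorphism of topological groups of `Π^tp_{X̲̲_k}` ([AbsAnab] Lem. 1.3.8 shape) and (H2) `Π^tp_{X̲̲_k}/Δ ≅ G_k`
as topological groups. [claim: Mochizuki2012, status: disputed] (IUTchII §1 Ex 1.8, kurims pp.35-41) -/
theorem nonempty_iff :
    Nonempty (AbsTopMonoids S) ↔
      (∀ f : S.PiX ≃ₜ* S.PiX, S.DeltaX.map f.toMulEquiv.toMonoidHom = S.DeltaX) ∧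
        Nonempty (TopGroup.quot S.PiX S.DeltaX ≃ₜ* S.Gk) :=
  ⟨fun ⟨A⟩ => ⟨A.deltaX_map_autEquiv, A.nonempty_quotDeltaX_iso⟩, fun ⟨hΔ, hq⟩ => ⟨degenerate hΔ hq⟩⟩

end AbsTopMonoids

end Literature.IUT.HodgeArakelov

end
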